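import Mathlib
import Summits.Ventures.HodgeRepro.Tier4.Common.RowPlane
import Summits.Ventures.HodgeRepro.Tier4.Common.MixedPlaneKType

/-!
# Tier4/Line4/TransportProbe — KERNEL-CERTIFIED WITNESS: under the wall's similitude convention
`_hiso : g * B_U * gᵀ = lam • B_{U′}`, the transported projectors `Q i = g * P i * g'` of `seesawPlane` (=
`withTransportedTorus g g'`) are NOT `B_U`-self-adjoint in general, while `g' * P i * g` are — so `torusT'
(seesawPlane …)` is the stabiliser of two NON-orthogonal lines (generically the centre), not the transported torus
of `U′`

Blind re-derivation cell `pub-hodge-repro`, Tier 4 «prove the step» (README §9–§10), seat t4-L4-p2 (gen 2; LINE L4,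
cut W4/W5).  Tree path `lean/Summits/Ventures/HodgeRepro/Tier4/Line4/TransportProbe.lean`.  Imports typer-2's
`Common/RowPlane` (`lineGramRow`, `PlaneData.mixedRow`, `blockDiag4`, `re4`) and `Common/MixedPlaneKType`
(`withTransportedTorus`).

THE ALGEBRA (row convention `v ↦ v g`).  `g * B_U * gᵀ = lam • B_{U′}` says `v ↦ v g` is a similitude
`(k⁴, B_{U′}) → (k⁴, B_U)`, and transports `U(B_{U′})` into `U(B_U)` by `x ↦ g⁻¹ x g` (check: `g⁻¹ x g B_U gᵀ xᵀ g⁻ᵀ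
= lam g⁻¹ x B_{U′} xᵀ g⁻ᵀ = lam g⁻¹ B_{U′} g⁻ᵀ = B_U`).  The torus of `U′` (the commutant of the standard projectors
`P i` in `U(B_{U′})`) therefore lands on the commutant of `g⁻¹ P i g = g' * P i * g` — and these projectors are
`B_U`-self-adjoint (`Q B_U = B_U Qᵀ`) exactly because `g'` pulls `B_U` back to `lam⁻¹ B_{U′}`.  The skeleton's
`seesawPlane q a g g' …` (Line4/Skeleton v0.15 L357–L361) is `(mixedRow q (a 0) (a 2)).withTransportedTorus g g' …`,
whose `Q i` is `g * P i * g'` (MixedPlaneKType L117–L122) with the SAME `g` as in `_hiso` — the transport in the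
opposite direction.  Its commutant in `U(B_U)` is the stabiliser of the two lines `im (g P i g')`, which are
`B_U`-orthogonal iff `g P i g'` is `B_U`-self-adjoint; when they are not, a unitary element preserving both lines
also preserves their `B_U`-orthogonal complements — three distinct `E′`-lines of a plane — and is an `E′_𝔸`-scalar:
`torusT' (seesawPlane …)` is then the CENTRE, and the wall's second torus is degenerate.

THE WITNESS (over `ℚ`, `ω = i`: `q = ⟨0, 1⟩`, `lineGramRow q a = (2a) • 1`, so every block is a scalar block):
`probeU := mixedRow q 1 1` (`B_U = diag(2, 2, −2, −2)`), `U′ := mixedRow q 1 4` (`B_{U′} = diag(2, 2, −8, −8)`),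
`g := D * b` with the hyperbolic rotation `b = [[5/3, 4/3], [4/3, 5/3]] ⊗ 1₂` (a `B_U`-isometry, `25 − 16 = 9`) and
`D = diag(1, 1, 2, 2)`: `g` commutes with `Ω`, `g * g' = g' * g = 1`, `g * B_U * gᵀ = B_U` scaled by `D` `=
B_{U′}` — i.e. `_hiso` with `lam = 1`, every binder of the wall's seesaw configuration.  Then
`Q₀ := g * P 0 * g'` has `Q₀ * B_U ≠ B_U * Q₀ᵀ` (the blocks `20/9` vs `80/9`), while `g' * P 0 * g` is
`B_U`-self-adjoint.  Everything is a `2 × 2`-block computation transported along `re4`.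

CONSEQUENCE FOR LINE L4 (for plan-4 / the critics; no theorem of the tree is touched): the wall `mixed_two_torus_W3`
/ `mixed_two_torus` quantifies over configurations in which its second torus is not the seesaw torus; the intended
configuration (`_hiso` for `g` AND the torus `g' T g`) is not an instance of its binders.  The one-token repair is
`seesawPlane q a g' g …` (transport by the inverse) with the matching `hgΩ`, or `_hiso` stated for `g'`.  Nothing
here bears on W4/W5's mathematics; it is a typing finding.  HC_CM is NOT proved by anyone in this repository.
-/

set_option autoImplicit false

noncomputable section

namespace Summit.Ventures.HodgeRepro.Tier4.Line4

open Matrix Summit.Ventures.HodgeRepro.Tier4.Common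

section Probe

/-- `E′ = ℚ(i)`: `ω² = −1`. -/
abbrev probeQ : QuadData ℚ := ⟨0, 1⟩

/-- A `4 × 4` matrix from four scalar `2 × 2` blocks `c • 1`. -/
def blk (c₁₁ c₁₂ c₂₁ c₂₂ : ℚ) : Matrix (Fin 4) (Fin 4) ℚ :=
  re4 (fromBlocks (c₁₁ • (1 : Matrix (Fin 2) (Fin 2) ℚ)) (c₁₂ • 1) (c₂₁ • 1) (c₂₂ • 1))

/-- Products of scalar-block matrices: the `2 × 2` block algebra. -/
theorem blk_mul (a b c d a' b' c' d' : ℚ) :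
    blk a b c d * blk a' b' c' d' = blk (a * a' + b * c') (a * b' + b * d') (c * a' + d * c') (c * b' + d * d') := by
  simp only [blk, ← map_mul, fromBlocks_multiply]
  congr 2 <;> ext i j <;> simp [Matrix.smul_apply, Matrix.one_apply] <;> split_ifs <;> ring

/-- The transpose of a scalar-block matrix. -/
theorem blk_transpose (a b c d : ℚ) : (blk a b c d)ᵀ = blk a c b d := by
  simp only [blk, re4, coe_reindexAlgEquiv, transpose_reindex, fromBlocks_transpose, transpose_smul, transpose_one]

/-- The identity as a scalar-block matrix. -/
theorem blk_one : blk 1 0 0 1 = 1 := by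
  simp only [blk, one_smul, zero_smul, fromBlocks_one, map_one]

/-- Scalar-block matrices are determined by their four scalars. -/
theorem blk_inj {a b c d a' b' c' d' : ℚ} (h : blk a b c d = blk a' b' c' d') :
    a = a' ∧ b = b' ∧ c = c' ∧ d = d' := by
  simp only [blk] at h
  have h' := fromBlocks_inj.mp (re4.injective h)
  obtain ⟨h1, h2, h3, h4⟩ := h'
  refine ⟨?_, ?_, ?_, ?_⟩
  · simpa using congrFun (congrFun h1 0) 0
  · simpa using congrFun (congrFun h2 0) 0
  · simpa using congrFun (congrFun h3 0) 0
  · simpa using congrFun (congrFun h4 0) 0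

/-- `blockDiag4 (c • 1) (d • 1) = blk c 0 0 d`. -/
theorem blockDiag4_scalar (c d : ℚ) : blockDiag4 (c • (1 : Matrix (Fin 2) (Fin 2) ℚ)) (d • 1) = blk c 0 0 d := by
  simp only [blockDiag4, blk, zero_smul]

/-- `lineGramRow probeQ a = (2a) • 1`. -/
theorem lineGramRow_gauss (a : ℚ) : lineGramRow probeQ a = (2 * a) • (1 : Matrix (Fin 2) (Fin 2) ℚ) := by
  ext i j; fin_cases i <;> fin_cases j <;> simp [lineGramRow] <;> ring

/-- The plane `probeU = mixedRow q 1 1`. -/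
abbrev probeU : PlaneData ℚ := PlaneData.mixedRow probeQ 1 1
/-- The plane `U′ = mixedRow q 1 4`. -/
abbrev probeU' : PlaneData ℚ := PlaneData.mixedRow probeQ 1 4

/-- The Gram matrix of `U`: `diag(2, 2, −2, −2)`. -/
theorem probeU_B : probeU.B = blk 2 0 0 (-2) := by
  show blockDiag4 (lineGramRow probeQ 1) ((-1 : ℚ) • lineGramRow probeQ 1) = _
  rw [lineGramRow_gauss, smul_smul, blockDiag4_scalar]; norm_num

/-- The Gram matrix of `U′`: `diag(2, 2, −8, −8)`. -/
theorem probeU'_B : probeU'.B = blk 2 0 0 (-8) := by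
  show blockDiag4 (lineGramRow probeQ 1) ((-1 : ℚ) • lineGramRow probeQ 4) = _
  rw [lineGramRow_gauss, lineGramRow_gauss, smul_smul, blockDiag4_scalar]; norm_num

/-- The first projector of `U`. -/
theorem probeU_P0 : probeU.P 0 = blk 1 0 0 0 := by
  show blockDiag4 1 0 = _
  rw [← blockDiag4_scalar 1 0]; simp

/-- `Ω = blockDiag4 ω ω` commutes with every `blk` (scalar blocks). -/
theorem omega_comm_blk (a b c d : ℚ) : blk a b c d * probeU.Ω = probeU.Ω * blk a b c d := by
  show blk a b c d * blockDiag4 (omegaMat probeQ) (omegaMat probeQ) =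
    blockDiag4 (omegaMat probeQ) (omegaMat probeQ) * blk a b c d
  simp only [blk, blockDiag4, ← map_mul, fromBlocks_multiply, Matrix.smul_mul, Matrix.mul_smul, Matrix.one_mul,
    Matrix.mul_one, Matrix.mul_zero, smul_zero, add_zero, zero_add]

/-- The witness similitude `g = D * b` (`D = diag(1, 1, 2, 2)`, `b` the hyperbolic rotation). -/
abbrev probeG : Matrix (Fin 4) (Fin 4) ℚ := blk (5/3) (4/3) (8/3) (10/3)
/-- The inverse of the witness similitude. -/
abbrev probeG' : Matrix (Fin 4) (Fin 4) ℚ := blk (5/3) (-2/3) (-4/3) (5/6)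

/-- `g * g' = 1`. -/
theorem probeG_mul_probeG' : probeG * probeG' = 1 := by
  rw [blk_mul, ← blk_one]; norm_num

/-- `g' * g = 1`. -/
theorem probeG'_mul_probeG : probeG' * probeG = 1 := by
  rw [blk_mul, ← blk_one]; norm_num

/-- `g` commutes with `Ω` (the wall's `hgΩ`). -/
theorem probeG_comm_omega : probeG * probeU.Ω = probeU.Ω * probeG := omega_comm_blk _ _ _ _

/-- **The wall's `_hiso` with `lam = 1`**: `g * B_U * gᵀ = B_{U′}`. -/
theorem probeG_similitude : probeG * probeU.B * probeGᵀ = (1 : ℚ) • probeU'.B := by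
  rw [probeU_B, probeU'_B, blk_transpose, blk_mul, blk_mul, one_smul]; norm_num

/-- The skeleton's transported projector `Q 0 = g * P 0 * g'`. -/
theorem seesaw_Q0 : (probeU.withTransportedTorus probeG probeG' probeG_mul_probeG' probeG'_mul_probeG probeG_comm_omega).Q 0 =
    blk (25/9) (-10/9) (40/9) (-16/9) := by
  rw [withTransportedTorus_Q, probeU_P0, blk_mul, blk_mul]; norm_num

/-- **THE DEFECT**: `Q 0` is NOT `B_U`-self-adjoint. -/
theorem seesaw_Q0_not_selfAdjoint :
    (probeU.withTransportedTorus probeG probeG' probeG_mul_probeG' probeG'_mul_probeG probeG_comm_omega).Q 0 * probeU.B ≠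
      probeU.B * ((probeU.withTransportedTorus probeG probeG' probeG_mul_probeG' probeG'_mul_probeG probeG_comm_omega).Q 0)ᵀ := by
  rw [seesaw_Q0, probeU_B, blk_transpose, blk_mul, blk_mul]
  intro h
  have := (blk_inj h).2.1
  norm_num at this

/-- **THE INTENDED TRANSPORT**: `g' * P 0 * g` IS `B_U`-self-adjoint. -/
theorem inverse_transport_selfAdjoint : (probeG' * probeU.P 0 * probeG) * probeU.B = probeU.B * (probeG' * probeU.P 0 * probeG)ᵀ := by
  rw [probeU_P0, probeU_B, blk_mul, blk_mul, blk_transpose, blk_mul, blk_mul]; norm_num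

end Probe

end Summit.Ventures.HodgeRepro.Tier4.Line4

end
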